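import Literature.Computability.AlgebraicComplexity.ValiantBooleanBridge
import Literature.Computability.AlgebraicComplexity.KIReductionCorrectness
import Literature.Computability.Complexity.ListBricks
import Literature.Computability.QuantumComplexity.BosonReductionCodes
import HarnessLib

/-!
# Kabanets–Impagliazzo, Cor. 12: code words of the instance and the format of the guess

Third file of the discharge of the reduction fact
`Literature.Computability.AlgebraicComplexity.permanent01Graph_polyExists_preimage_PIT`
(`PermanentGraphNSUBEXP.lean`). String-level bookkeeping, no machines yet:

**Part 1 — the target codes.** The instance `kiCircuit n M v P` (`KIReductionInstance.lean`) is
submitted to `PITLanguage` (`ValiantBooleanBridge.lean`) as the word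
`circuitWord m C = ⟨bin m, encodeArithCircuit m C⟩`. We spell the tree's encodings
(`operandEncoding`, `gateEncoding`, `arithCircuitEncoding`: tag bits, `Encoding.listBool`,
`Encoding.pairBool`, binary numerals) out as explicit strings — `intCode`, `opCode`, `gateCode`,
`encodeArithCircuit_eq` (the gate list is `⟨1^{#gates}, encList (codes)⟩`, so the items are the
CONCATENATION of the frames `⟨code, ε⟩` of the gate codes, which is how the machine writes them) —
and record `circuitWord_mem_PITLanguage` and the rejected word `badWord ∉ PITLanguage`.

**Part 2 — the format of the guess.** The guess `y` is read TOTALLY: every string denotes a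
family of gate lists (`readBlocks y : ℕ → KBlock`), through the junk-tolerant pair projections
`fstF`/`sndF` of the brick algebra only, so that the reduction machine and this reading agree on
every input and soundness (`kiCircuit_sound`, for every family) applies to every `y`:
* `readList w` — the items `fstF w, fstF (sndF w), …` of an arbitrary string (the walk every list
  brick performs; `readList (encList L) = L`);
* `readOp`, `readKind`, `readGate`, `readBlock`, `readBlocks` — operands `⟨cls, u⟩` (class by the
  first bits of `cls`, reference index `|u|` in UNARY, so that relocation is a concatenation),
  kinds, gates `⟨kind, ⟨a, b⟩⟩`, blocks, block families;
* the honest encoders `encOp`, `encGate`, `encBlock`, `encBlocks` with `read ∘ enc = id` and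
  length bounds linear in the reference indices (polynomial witnesses for `exists_good_blocks`).

## References

* V. Kabanets, R. Impagliazzo, *Derandomizing polynomial identity tests means proving circuit
  lower bounds*, STOC 2003, Lemma 11 and proof of Cor. 12 (p. 358).
* S. Arora, B. Barak, *Computational Complexity: A Modern Approach*, CUP 2009, §0.1 (codes of
  tuples and lists).
-/

noncomputable section

namespace Literature.Computability.AlgebraicComplexity

namespace KIReduction

open _root_.Computability Complexity Brick ArithCircuit

/-! The code `intCode` of an integer constant or coefficient (`encodingIntBool`: sign bit paired with
the binary magnitude) and its first lemmas are those of `QuantumComplexity/BosonReductionCodes.lean`,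
re-exported into this namespace. -/
export QuantumComplexity.BosonCodes (intCode intCode_eq intCode_zero)

/-! ## Part 1: code words of operands, gates, circuits -/

/-- `intCode 1 = 00011`. [folklore] -/
theorem intCode_one : intCode 1 = [false, false, false, true, true] := rfl

/-- `intCode (-1) = 11011`. [folklore] -/
theorem intCode_neg_one : intCode (-1) = [true, true, false, true, true] := rfl

/-- The code of an operand over `m` variables (`operandEncoding m`). [cite: KabanetsImpagliazzo2004, §2] -/
def opCode (m : ℕ) (u : Operand ℤ (Fin m)) : List Bool := (operandEncoding m).encode u

/-- Code of a variable: `00 · bin k`. [folklore] -/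
@[simp] theorem opCode_var (m : ℕ) (k : Fin m) : opCode m (.var k) = false :: false :: encodeNat k.val := rfl

/-- Code of a constant: `01 · intCode c`. [folklore] -/
@[simp] theorem opCode_const (m : ℕ) (c : ℤ) : opCode m (.const c) = false :: true :: intCode c := rfl

/-- Code of a gate reference: `1 · bin j`. [folklore] -/
@[simp] theorem opCode_gate (m : ℕ) (j : ℕ) : opCode m (.gate j) = true :: encodeNat j := rfl

/-- The right fold of `boolPair` is `encList` (twin, outside this file's import cone:
`S2D.foldr_boolPair_eq_encList`, `Cryptography/LWESearchToDecisionMachine.lean`). [folklore] -/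
theorem foldr_boolPair_eq_encList {α : Type} (f : α → List Bool) (l : List α) :
    l.foldr (fun a acc => boolPair (f a) acc) [] = encList (l.map f) := by
  induction l with
  | nil => rfl
  | cons a l ih => rw [List.foldr_cons, ih, List.map_cons, encList_cons]

/-- **The list code spelled out**: `⟨1^{|l|}, encList (codes)⟩` (twin, outside this file's import cone:
`LWE.listBool_encode_eq_encList`, `Cryptography/LWESampleCodes.lean`). [cite: AroraBarakCC2009, §0.1] -/
theorem listBool_encode_eq {α : Type} (e : Encoding α Bool) (l : List α) :
    e.listBool.encode l = boolPair (ones l.length) (encList (l.map e.encode)) := by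
  change boolPair (unaryEncodeNat l.length) (l.foldr (fun a acc => boolPair (e.encode a) acc) []) = _
  rw [OracleCompose.unaryEncodeNat_eq_replicate, foldr_boolPair_eq_encList]

/-- The code of a gate over `m` variables (`gateEncoding m`). [cite: KabanetsImpagliazzo2004, §2] -/
def gateCode (m : ℕ) (g : Gate ℤ (Fin m)) : List Bool := (gateEncoding m).encode g

/-- **Code of a sum gate**: `0 · ⟨1^{#args}, encList [⟨intCode c, opCode u⟩ …]⟩`. [folklore] -/
theorem gateCode_sum (m : ℕ) (args : List (ℤ × Operand ℤ (Fin m))) :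
    gateCode m (.sum args) =
      false :: boolPair (ones args.length) (encList (args.map fun a => boolPair (intCode a.1) (opCode m a.2))) := by
  change false :: (encodingIntBool.pairBool (operandEncoding m)).listBool.encode args = _
  rw [listBool_encode_eq]
  rfl

/-- **Code of a product gate**: `1 · ⟨1^{#args}, encList [opCode u …]⟩`. [folklore] -/
theorem gateCode_prod (m : ℕ) (args : List (Operand ℤ (Fin m))) :
    gateCode m (.prod args) = true :: boolPair (ones args.length) (encList (args.map (opCode m))) := by
  change true :: (operandEncoding m).listBool.encode args = _
  rw [listBool_encode_eq]
  rfl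

/-- **The circuit code spelled out**: `⟨⟨1^{#gates}, encList (gate codes)⟩, opCode output⟩`. [cite: KabanetsImpagliazzo2004, §2] -/
theorem encodeArithCircuit_eq (m : ℕ) (C : ArithCircuit ℤ (Fin m)) :
    encodeArithCircuit m C =
      boolPair (boolPair (ones C.gates.length) (encList (C.gates.map (gateCode m)))) (opCode m C.output) := by
  change boolPair ((gateEncoding m).listBool.encode C.gates) ((operandEncoding m).encode C.output) = _
  rw [listBool_encode_eq]
  rfl

/-- The word submitted to `PITLanguage` for a circuit over `m` variables: `⟨bin m, ⟨C⟩⟩`. [cite: KabanetsImpagliazzo2004, §2] -/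
def circuitWord (m : ℕ) (C : ArithCircuit ℤ (Fin m)) : List Bool := boolPair (encodeNat m) (encodeArithCircuit m C)

/-- Membership of a circuit word in `PITLanguage` is vanishing of the computed polynomial. [cite: KabanetsImpagliazzo2004, §2] -/
theorem circuitWord_mem_PITLanguage (m : ℕ) (C : ArithCircuit ℤ (Fin m)) :
    circuitWord m C ∈ PITLanguage ↔ C.eval = 0 :=
  mem_PITLanguage_iff m C

/-- **The rejected word**: the code of the constant circuit `1` over no variables. [folklore] -/
def badWord : List Bool := circuitWord 0 (ofConst 1)

/-- The rejected word is not an identity. [folklore] -/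
theorem badWord_not_mem_PITLanguage : badWord ∉ PITLanguage := by
  rw [badWord, circuitWord_mem_PITLanguage, eval_ofConst]
  exact one_ne_zero

/-- **The items of a list code are the concatenation of the frames of its codes**:
`encList (l ++ [a]) = encList l ++ ⟨a, ε⟩`, so a gate list is written by appending frames (twin, outside
this file's import cone: `FarCertMachine.encList_append_singleton`, `Algebra/EuclideanLattices/FarCertMachineCodes.lean`). [folklore] -/
theorem encList_append_singleton (l : List (List Bool)) (a : List Bool) :
    encList (l ++ [a]) = encList l ++ boolPair a [] := by
  induction l with
  | nil => rfl
  | cons b l ih =>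
    rw [List.cons_append, encList_cons, ih, encList_cons]
    simp [boolPair, List.append_assoc]

/-- `encList` of a concatenation (twin, outside this file's import cone: `FregeTransl.encList_append`,
`MetaComplexity/FregeTranslation.lean`). [folklore] -/
theorem encList_append (l l' : List (List Bool)) : encList (l ++ l') = encList l ++ encList l' := by
  induction l with
  | nil => rfl
  | cons b l ih => rw [List.cons_append, encList_cons, ih, encList_cons]; simp [boolPair, List.append_assoc]

/-! ## Part 2: reading the guess -/

/-! ### The items of an arbitrary string -/

/-- The second projection of a nonempty string is shorter. [folklore] -/
theorem length_sndF_lt {w : List Bool} (h : w ≠ []) : (sndF w).length < w.length := by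
  match w, h with
  | [_], _ => simp [sndF, boolUnpair]
  | b :: b' :: rest, _ =>
    have := length_boolUnpair_parts_le rest
    cases b <;> cases b' <;> simp [sndF, boolUnpair] <;> omega

/-- **The items of a string**: `fstF w, fstF (sndF w), fstF (sndF² w), …` as long as the remainder
is nonempty — the walk that every list brick performs; on a list code these are its items
(`readList_encList`). [folklore] -/
def readList (w : List Bool) : List (List Bool) :=
  if _h : w = [] then [] else fstF w :: readList (sndF w)
termination_by w.length
decreasing_by exact length_sndF_lt _h

/-- No items in the empty string. [folklore] -/
@[simp] theorem readList_nil : readList [] = [] := by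
  rw [readList]; rfl

/-- The items of a nonempty string. [folklore] -/
theorem readList_of_ne_nil {w : List Bool} (h : w ≠ []) : readList w = fstF w :: readList (sndF w) := by
  rw [readList, dif_neg h]

/-- A pair contributes its first component as an item. [folklore] -/
@[simp] theorem readList_boolPair (a w : List Bool) : readList (boolPair a w) = a :: readList w := by
  rw [readList_of_ne_nil (by simp [boolPair])]
  simp

/-- The items of a list code are its items. [folklore] -/
@[simp] theorem readList_encList (L : List (List Bool)) : readList (encList L) = L := by
  induction L with
  | nil => simp
  | cons a L ih => rw [encList_cons, readList_boolPair, ih]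

/-- **Items by iterated projections**: item `i` (junk `ε` past the end) is `fstF (sndFⁱ w)` — the
form in which bricks access items (`HashBricks.nthItemFn`). [folklore] -/
theorem getD_readList (w : List Bool) (i : ℕ) : (readList w).getD i [] = fstF (sndF^[i] w) := by
  induction i generalizing w with
  | zero =>
    by_cases h : w = []
    · subst h; simp
    · rw [readList_of_ne_nil h]; simp
  | succ i ih =>
    by_cases h : w = []
    · subst h; simp
    · rw [readList_of_ne_nil h, List.getD_cons_succ, ih, Function.iterate_succ_apply]

/-- There are at most `|w|` items. [folklore] -/
theorem length_readList_le (w : List Bool) : (readList w).length ≤ w.length := by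
  induction w using readList.induct with
  | case1 => simp
  | case2 w h ih =>
    rw [readList_of_ne_nil h, List.length_cons]
    have := length_sndF_lt h
    omega

/-- Past the last item the remainder is empty. [folklore] -/
theorem iterate_sndF_eq_nil (w : List Bool) {i : ℕ} (hi : (readList w).length ≤ i) : sndF^[i] w = [] := by
  induction i generalizing w with
  | zero =>
    by_cases h : w = []
    · exact h
    · rw [readList_of_ne_nil h] at hi; simp at hi
  | succ i ih =>
    by_cases h : w = []
    · subst h; simp
    · rw [readList_of_ne_nil h, List.length_cons] at hi
      rw [Function.iterate_succ_apply]
      exact ih (sndF w) (by omega)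

/-- Conversely, if the remainder after `i` steps is empty, there are at most `i` items. [folklore] -/
theorem length_readList_le_of_iterate_sndF_eq_nil : ∀ (i : ℕ) (w : List Bool), sndF^[i] w = [] → (readList w).length ≤ i
  | 0, w, hw => by simp only [Function.iterate_zero, id_eq] at hw; subst hw; simp
  | i + 1, w, hw => by
    by_cases hw0 : w = []
    · subst hw0; simp
    · rw [readList_of_ne_nil hw0, List.length_cons]
      rw [Function.iterate_succ_apply] at hw
      have := length_readList_le_of_iterate_sndF_eq_nil i _ hw
      omega

/-- Before the last item the remainder is nonempty. [folklore] -/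
theorem iterate_sndF_ne_nil (w : List Bool) {i : ℕ} (hi : i < (readList w).length) : sndF^[i] w ≠ [] := fun h =>
  absurd (length_readList_le_of_iterate_sndF_eq_nil i w h) (by omega)

/-! ### Operands, kinds, gates, blocks -/

/-- **Reading an operand** `o = ⟨cls, u⟩`: empty class = reference to position `|u|` (unary
index); otherwise a constant, `1` if `cls` starts with `1`, `-1` if `cls = 0`, `0` otherwise. [folklore] -/
def readOp (o : List Bool) : KOp :=
  if fstF o = [] then .ref (sndF o).length
  else if (fstF o).headD false then .one
  else if (fstF o).length ≤ 1 then .negOne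
  else .zero

/-- **Reading a kind**: `ε ↦ +`, `1… ↦ −`, `0 ↦ ×`, longer `0… ↦ −·−`. [folklore] -/
def readKind (k : List Bool) : KKind :=
  if k = [] then .add else if k.headD false then .sub else if k.length ≤ 1 then .mul else .negAdd

/-- **Reading a gate** `g = ⟨kind, ⟨a, b⟩⟩`. [folklore] -/
def readGate (g : List Bool) : KGate := ⟨readKind (fstF g), readOp (fstF (sndF g)), readOp (sndF (sndF g))⟩

/-- **Reading a block**: the gates of the items. [folklore] -/
def readBlock (b : List Bool) : KBlock := (readList b).map readGate

/-- **Reading the guess**: block `i` is read off item `i` (junk `ε`, the empty block, past the end). [cite: KabanetsImpagliazzo2003, proof of Cor. 12 (p. 358)] -/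
def readBlocks (y : List Bool) (i : ℕ) : KBlock := readBlock (fstF (sndF^[i] y))

/-- `readBlocks` through the items. [folklore] -/
theorem readBlocks_eq (y : List Bool) (i : ℕ) : readBlocks y i = readBlock ((readList y).getD i []) := by
  rw [readBlocks, getD_readList]

/-- A block has at most as many gates as its string has symbols. [folklore] -/
theorem length_readBlock_le (b : List Bool) : (readBlock b).length ≤ b.length := by
  rw [readBlock, List.length_map]; exact length_readList_le b

/-! ### The honest encoders -/

/-- Code of an operand. [folklore] -/
def encOp : KOp → List Bool
  | .ref i => boolPair [] (ones i)
  | .one => boolPair [true] []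
  | .negOne => boolPair [false] []
  | .zero => boolPair [false, false] []

/-- Code of a kind. [folklore] -/
def encKind : KKind → List Bool
  | .add => []
  | .sub => [true]
  | .mul => [false]
  | .negAdd => [false, false]

/-- Code of a gate. [folklore] -/
def encGate (g : KGate) : List Bool := boolPair (encKind g.kind) (boolPair (encOp g.a) (encOp g.b))

/-- Code of a block. [folklore] -/
def encBlock (B : KBlock) : List Bool := encList (B.map encGate)

/-- Code of a guess. [folklore] -/
def encBlocks (Ps : List KBlock) : List Bool := encList (Ps.map encBlock)

/-- Operands are read back. [folklore] -/
@[simp] theorem readOp_encOp (u : KOp) : readOp (encOp u) = u := by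
  cases u <;> simp [readOp, encOp, ones]

/-- Kinds are read back. [folklore] -/
@[simp] theorem readKind_encKind (kd : KKind) : readKind (encKind kd) = kd := by
  cases kd <;> simp [readKind, encKind]

/-- Gates are read back. [folklore] -/
@[simp] theorem readGate_encGate (g : KGate) : readGate (encGate g) = g := by
  obtain ⟨kd, a, b⟩ := g
  simp [readGate, encGate]

/-- Blocks are read back. [folklore] -/
@[simp] theorem readBlock_encBlock (B : KBlock) : readBlock (encBlock B) = B := by
  simp [readBlock, encBlock, List.map_map, Function.comp_def]

/-- A guess is read back (the empty block past the end). [folklore] -/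
theorem readBlocks_encBlocks (Ps : List KBlock) (i : ℕ) : readBlocks (encBlocks Ps) i = Ps.getD i [] := by
  rw [readBlocks_eq, encBlocks, readList_encList, List.getD_eq_getElem?_getD, List.getElem?_map,
    List.getD_eq_getElem?_getD]
  cases Ps[i]? with
  | none => simp [readBlock]
  | some B => simp

/-! ### Lengths of the honest codes -/

/-- Length of an operand code: the unary index plus two, or at most six. [folklore] -/
theorem length_encOp_le (u : KOp) : (encOp u).length ≤ u.idx + 6 := by
  cases u with
  | ref i => simp only [encOp, KOp.idx, length_boolPair, ones, List.length_replicate, List.length_nil]; omega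
  | one => simp [encOp, KOp.idx]
  | negOne => simp [encOp, KOp.idx]
  | zero => simp [encOp, KOp.idx]

/-- Length of a gate code. [folklore] -/
theorem length_encGate_le (g : KGate) : (encGate g).length ≤ 2 * g.a.idx + g.b.idx + 28 := by
  obtain ⟨kd, a, b⟩ := g
  have ha := length_encOp_le a
  have hb := length_encOp_le b
  have hk : (encKind kd).length ≤ 2 := by cases kd <;> simp [encKind]
  simp only [encGate, length_boolPair]
  omega

/-- Length of a list code in terms of a uniform bound on its items (twin, outside this file's import
cone: `DinurSafraFP.length_encList_le_of_bound`, `Complexity/CSPToCMMSAReductionProofs.lean`). [folklore] -/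
theorem length_encList_le {L : List (List Bool)} {b : ℕ} (h : ∀ a ∈ L, a.length ≤ b) :
    (encList L).length ≤ L.length * (2 * b + 2) := by
  induction L with
  | nil => simp
  | cons a L ih =>
    rw [encList_cons, length_boolPair, List.length_cons]
    have h1 := h a (by simp)
    have h2 := ih fun a' ha' => h a' (by simp [ha'])
    have h3 : (L.length + 1) * (2 * b + 2) = L.length * (2 * b + 2) + (2 * b + 2) := by ring
    omega

/-- **Length of a block code** whose references stay below `m`: at most `|B| · (6 m + 58)`. [folklore] -/
theorem length_encBlock_le {B : KBlock} {m : ℕ} (h : ∀ g ∈ B, g.a.idx < m ∧ g.b.idx < m) :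
    (encBlock B).length ≤ B.length * (6 * m + 58) := by
  have hb : ∀ a ∈ B.map encGate, a.length ≤ 3 * m + 28 := by
    intro a ha
    rw [List.mem_map] at ha
    obtain ⟨g, hg, rfl⟩ := ha
    have := length_encGate_le g
    have := h g hg
    omega
  have := length_encList_le hb
  rw [List.length_map] at this
  rw [encBlock]
  calc (encList (B.map encGate)).length ≤ B.length * (2 * (3 * m + 28) + 2) := this
    _ = B.length * (6 * m + 58) := by ring

/-- **Length of the code of a guess** with `k` blocks of at most `s` gates, references inside
their uses (`N` inputs): at most `k · (2 s (6 (N + s) + 58) + 2)`. [folklore] -/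
theorem length_encBlocks_le {Ps : List KBlock} {N s : ℕ} (hs : ∀ B ∈ Ps, B.length ≤ s)
    (h : ∀ B ∈ Ps, ∀ g ∈ B, g.a.idx < N + B.length ∧ g.b.idx < N + B.length) :
    (encBlocks Ps).length ≤ Ps.length * (2 * (s * (6 * (N + s) + 58)) + 2) := by
  have hb : ∀ a ∈ Ps.map encBlock, a.length ≤ s * (6 * (N + s) + 58) := by
    intro a ha
    rw [List.mem_map] at ha
    obtain ⟨B, hB, rfl⟩ := ha
    have h1 := length_encBlock_le (m := N + B.length) (h B hB)
    have h2 := hs B hB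
    calc (encBlock B).length ≤ B.length * (6 * (N + B.length) + 58) := h1
      _ ≤ s * (6 * (N + s) + 58) := Nat.mul_le_mul h2 (by omega)
  have := length_encList_le hb
  rwa [List.length_map] at this

end KIReduction

end Literature.Computability.AlgebraicComplexity

end
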